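import Literature.Barriers.AnomalousDissipation.ConvexIntegrationNonLeray
import Literature.Analysis.FluidPDE.LerayHopf
import HarnessLib

/-!
# Barrier (AnomalousDissipation), narrowed companion of `ConvexIntegrationNonLeray`:
  the energy ceiling is inherited by `C⁰_t L²` limits of unforced Leray–Hopf solutions

D-0021 barrier audit (2026-08-17) of `Literature/Barriers/AnomalousDissipation/ConvexIntegrationNonLeray`
and its proof file `…Proofs`. The parent block records, as a *documented gap*, that convex
integration reaches Navier–Stokes only in the weak (Oseen) class (Buckmaster–Vicol 2019,
Thm. 1.3, now the tree theorem `BuckmasterVicol2019_thm13_holds`) and that "no printed theorem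
excludes a Leray–Hopf (or classical) vanishing-viscosity realisation of a convex-integration
solution". The second clause is narrowed here by an elementary theorem, proved below: in the very
convergence mode of Thm. 1.3 — `sup_{t ∈ [0,T]} ‖v_n(t) - u(t)‖_{L²} → 0` — limits of *unforced
Leray–Hopf* solutions `v_n` (any viscosities `ν_n ≥ 0`, any data) have `t ↦ ‖u(t)‖_{L²}`
non-increasing on `[0,T]` (when continuous; in general non-increasing from a.e. time on, and below
`‖u(0)‖_{L²}` when the data converge to `u(0)` in `L²`), because the Leray–Hopf energy
inequalities (`Torus.IsLerayHopfOn.energy_ineq_zero/energy_ineq_ae`) have zero work term and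
pass to strong `L²` limits. Hence every weak Euler flow whose kinetic energy is not non-increasing
— all Onsager-flexibility flows with a non-monotone prescribed profile
(`Literature.Analysis.FluidPDE.onsager_flexibility`), all non-trivial flows at rest at `t = 0`
(Isett 2018, Thm. 1: compact time support) — is formally excluded from such a realisation,
although it *is* a `C⁰_t L²` limit of weak Navier–Stokes solutions by Thm. 1.3. The question recorded as unsettled by the parent
[Buckmaster–Vicol 2019, §1.2; Bruè–De Lellis 2023, §2] therefore concerns *dissipative*
(energy non-increasing) convex-integration flows only and, for suitable/Leray approximants in the
strong `L³_{t,x}` topology, *locally* dissipative ones (Duchon–Robert 2000, Prop. 4: `D(u) ≥ 0`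
for such limits; Giri–Kwon–Novack 2026, p. 3), a class that convex integration populates up to
the Onsager exponent (Isett 2022; De Lellis–Kwon 2022; Giri–Kwon–Novack 2026, Thm. 1.1).

## What is proved

* `IsLerayHopfOn.eLpNorm_le_initial_of_unforced`, `IsLerayHopfOn.eLpNorm_le_ae_of_unforced` —
  the energy ceilings of one unforced Leray–Hopf solution (from `0`; from a.e. `s`).
* `lerayHopfLimit_eLpNorm_le_initial` — the ceiling from `t = 0` is inherited by `C⁰_t L²` limits
  with `L²`-convergent data; `lerayHopfLimit_eLpNorm_le_ae` — the a.e.-in-`s` ceilings are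
  inherited (any data); `lerayHopfLimit_eLpNorm_antitoneOn` — hence `t ↦ ‖u(t)‖_{L²}` is
  non-increasing on `[0,T]` as soon as it is continuous (main theorem);
  `lerayHopfLimit_kineticEnergy_le_initial` — the same for `Torus.kineticEnergy (u t)`
  (= `Literature.Analysis.FluidPDE.energyProfile u t`).
* `ConvexIntegrationNonLerayEnergyCeilingNarrow` — the narrowed barrier statement (a `Prop`, house
  style of the catalogue, with its BARRIER block) and `…_holds`, its proof.
* `not_lerayHopfLimit_of_eLpNorm_lt_of_le`, `not_lerayHopfLimit_of_eLpNorm_lt`,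
  `not_lerayHopfLimit_of_rest` — the exclusions (energy gain between two times; above the initial
  energy; rest at `t = 0`).

## References

* T. Buckmaster, V. Vicol, Ann. of Math. 189 (2019), Thm. 1.3 and §1.2 (arXiv:1709.10033, p. 4).
* E. Bruè, C. De Lellis, Comm. Math. Phys. 400 (2023), §2 (arXiv:2207.06301, p. 5).
* J. Duchon, R. Robert, Nonlinearity 13 (2000), Prop. 4.
* V. Giri, H. Kwon, M. Novack, Ann. of Math. 204 (2026) (arXiv:2305.18509 (2023), p. 3 and Thm. 1.1). [`GiriKwonNovack2026`]
* P. Isett, Ann. of Math. 188 (2018), Thm. 1; P. Isett, Arch. Ration. Mech. Anal. 244 (2022);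
  C. De Lellis, H. Kwon, Anal. PDE 15 (2022), Thm. 1.1.
* J. Leray, Acta Math. 63 (1934), (5.2); E. Hopf, Math. Nachr. 4 (1951).
-/

open MeasureTheory Set Filter Topology
open scoped ENNReal NNReal InnerProductSpace

noncomputable section

namespace Literature.Barriers.AnomalousDissipation

open Literature.Analysis.FunctionSpaces Literature.Analysis.FluidPDE

/-- The flat three-torus `T³ = (ℝ/ℤ)³` (local notation). -/
local notation "𝕋³" => UnitAddTorus (Fin 3)
/-- Velocity values (local notation). -/
local notation "E³" => EuclideanSpace ℝ (Fin 3)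

/-! ## Two `L²` lemmas -/

/-- `E(w) = ½ ‖w‖²_{L²}` for `w ∈ L²(T³)` (kinetic energy through the `L²` norm). [folklore] -/
theorem kineticEnergy_eq_half_toReal_sq {w : 𝕋³ → E³} (hw : MemLp w 2 volume) :
    Torus.kineticEnergy w = 2⁻¹ * (eLpNorm w 2 volume).toReal ^ 2 := by
  have h := hw.eLpNorm_eq_integral_rpow_norm two_ne_zero ENNReal.ofNat_ne_top
  have hint : ∫ x, ‖w x‖ ^ (2 : ℝ≥0∞).toReal = ∫ x, ‖w x‖ ^ 2 := by
    refine integral_congr_ae (Eventually.of_forall fun x => ?_)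
    simp only [ENNReal.toReal_ofNat, Real.rpow_two]
  rw [hint, ENNReal.toReal_ofNat] at h
  have hI : 0 ≤ ∫ x, ‖w x‖ ^ 2 := integral_nonneg fun _ => sq_nonneg _
  unfold Torus.kineticEnergy
  rw [h, ENNReal.toReal_ofReal (by positivity), show (2 : ℝ)⁻¹ = 1 / 2 by norm_num,
    ← Real.sqrt_eq_rpow, Real.sq_sqrt hI]

/-- For `f, g ∈ L²(T³)`, `E(f) ≤ E(g)` gives `‖f‖_{L²} ≤ ‖g‖_{L²}`. [folklore] -/
theorem eLpNorm_le_of_kineticEnergy_le {f g : 𝕋³ → E³} (hf : MemLp f 2 volume)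
    (hg : MemLp g 2 volume) (h : Torus.kineticEnergy f ≤ Torus.kineticEnergy g) :
    eLpNorm f 2 volume ≤ eLpNorm g 2 volume := by
  rw [kineticEnergy_eq_half_toReal_sq hf, kineticEnergy_eq_half_toReal_sq hg] at h
  have ha : 0 ≤ (eLpNorm f 2 volume).toReal := ENNReal.toReal_nonneg
  have hb : 0 ≤ (eLpNorm g 2 volume).toReal := ENNReal.toReal_nonneg
  have h2 : (eLpNorm f 2 volume).toReal ^ 2 ≤ (eLpNorm g 2 volume).toReal ^ 2 := by linarith
  have h1 : (eLpNorm f 2 volume).toReal ≤ (eLpNorm g 2 volume).toReal :=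
    (pow_le_pow_iff_left₀ ha hb two_ne_zero).1 h2
  exact (ENNReal.toReal_le_toReal hf.eLpNorm_ne_top hg.eLpNorm_ne_top).1 h1

/-- Uniform-in-time `L²` convergence on `[0,T]` gives convergence of each slice. [folklore] -/
theorem tendsto_eLpNorm_slice_of_tendsto_iSup {T : ℝ} {u : ℝ → 𝕋³ → E³} {v : ℕ → ℝ → 𝕋³ → E³}
    (hconv : Tendsto (fun n => ⨆ t ∈ Icc 0 T, eLpNorm (v n t - u t) 2 volume) atTop (𝓝 0))
    {t : ℝ} (ht : t ∈ Icc 0 T) : Tendsto (fun n => eLpNorm (v n t - u t) 2 volume) atTop (𝓝 0) := by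
  refine tendsto_of_tendsto_of_tendsto_of_le_of_le tendsto_const_nhds hconv
    (fun _ => zero_le) (fun n => ?_)
  exact le_iSup₂ (f := fun s (_ : s ∈ Icc 0 T) => eLpNorm (v n s - u s) 2 volume) t ht

/-- Reverse triangle inequality in the form used below: `‖f‖_{L²} ≤ ‖g‖_{L²} + ‖g - f‖_{L²}` for
`f, g ∈ L²`. [folklore] -/
theorem eLpNorm_le_add_eLpNorm_sub {f g : 𝕋³ → E³} (hf : MemLp f 2 volume) (hg : MemLp g 2 volume) :
    eLpNorm f 2 volume ≤ eLpNorm g 2 volume + eLpNorm (g - f) 2 volume := by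
  have heq : f = g + (f - g) := by abel
  calc eLpNorm f 2 volume = eLpNorm (g + (f - g)) 2 volume := by rw [← heq]
    _ ≤ eLpNorm g 2 volume + eLpNorm (f - g) 2 volume :=
        eLpNorm_add_le hg.aestronglyMeasurable (hf.aestronglyMeasurable.sub hg.aestronglyMeasurable)
          one_le_two
    _ = eLpNorm g 2 volume + eLpNorm (g - f) 2 volume := by rw [eLpNorm_sub_comm]

/-- The same with the difference written `f - g`. [folklore] -/
theorem eLpNorm_le_add_eLpNorm_sub' {f g : 𝕋³ → E³} (hf : MemLp f 2 volume) (hg : MemLp g 2 volume) :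
    eLpNorm f 2 volume ≤ eLpNorm g 2 volume + eLpNorm (f - g) 2 volume := by
  rw [eLpNorm_sub_comm]
  exact eLpNorm_le_add_eLpNorm_sub hf hg

/-! ## The energy ceiling of an unforced Leray–Hopf solution and of its limits -/

/-- An unforced Leray–Hopf solution on `T³ × [0,T)` (accepted `Torus.IsLerayHopfOn`, force `0`,
datum `u₀ ∈ L²`, viscosity `ν ≥ 0`) stays below its initial energy in `L²`:
`‖v(t)‖_{L²} ≤ ‖u₀‖_{L²}` for `t ∈ [0,T]` (Leray 1934, (5.2): the energy inequality from `0`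
with zero work term and nonnegative dissipation). [cite: Leray1934, §III (5.2)] -/
theorem IsLerayHopfOn.eLpNorm_le_initial_of_unforced {T ν : ℝ} (hν : 0 ≤ ν) {u₀ : 𝕋³ → E³}
    {v : ℝ → 𝕋³ → E³} (hv : Torus.IsLerayHopfOn T ν 0 u₀ v) (hu₀ : MemLp u₀ 2 volume) {t : ℝ}
    (ht : t ∈ Icc 0 T) : eLpNorm (v t) 2 volume ≤ eLpNorm u₀ 2 volume := by
  have hE := hv.energy_ineq_zero t ht
  simp only [Pi.zero_apply, inner_zero_left, integral_zero, intervalIntegral.integral_zero,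
    add_zero] at hE
  have hdiss : 0 ≤ ν * (∫⁻ τ in Ioo 0 t, Torus.eGradNormSq (v τ)).toReal :=
    mul_nonneg hν ENNReal.toReal_nonneg
  exact eLpNorm_le_of_kineticEnergy_le (hv.memLp t ht) hu₀ (by linarith)

/-- An unforced Leray–Hopf solution is, from almost every time `s ∈ (0,T)` on, below its energy
at `s`: for a.e. `s` and every `t ∈ [s,T]`, `‖v(t)‖_{L²} ≤ ‖v(s)‖_{L²}` (the energy inequality
from a.e. `s`, Leray 1934, (5.1), with zero work term). [cite: Leray1934, §III (5.1)] -/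
theorem IsLerayHopfOn.eLpNorm_le_ae_of_unforced {T ν : ℝ} (hν : 0 ≤ ν) {u₀ : 𝕋³ → E³}
    {v : ℝ → 𝕋³ → E³} (hv : Torus.IsLerayHopfOn T ν 0 u₀ v) :
    ∀ᵐ s ∂(volume.restrict (Ioo 0 T)), ∀ t ∈ Icc s T,
      eLpNorm (v t) 2 volume ≤ eLpNorm (v s) 2 volume := by
  filter_upwards [hv.energy_ineq_ae, ae_restrict_mem measurableSet_Ioo] with s hs hsmem t ht
  have hE := hs t ht
  simp only [Pi.zero_apply, inner_zero_left, integral_zero, intervalIntegral.integral_zero,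
    add_zero] at hE
  have hdiss : 0 ≤ ν * (∫⁻ τ in Ioo s t, Torus.eGradNormSq (v τ)).toReal :=
    mul_nonneg hν ENNReal.toReal_nonneg
  have hsI : s ∈ Icc 0 T := ⟨hsmem.1.le, hsmem.2.le⟩
  have htI : t ∈ Icc 0 T := ⟨hsmem.1.le.trans ht.1, ht.2⟩
  exact eLpNorm_le_of_kineticEnergy_le (hv.memLp t htI) (hv.memLp s hsI) (by linarith)

/-- **The energy ceiling is inherited by `C⁰_t L²` limits of unforced Leray–Hopf solutions.**
Let `u : ℝ → T³ → ℝ³` have square-integrable slices on `[0,T]`, and let `v_n` be unforced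
Leray–Hopf solutions on `T³ × [0,T)` with viscosities `ν_n ≥ 0` and data `u₀ⁿ ∈ L²` such that
`u₀ⁿ → u(0)` in `L²` and `sup_{t ∈ [0,T]} ‖v_n(t) - u(t)‖_{L²} → 0` (the convergence of
Buckmaster–Vicol 2019, Thm. 1.3, there for *weak* solutions). Then `‖u(t)‖_{L²} ≤ ‖u(0)‖_{L²}` for
every `t ∈ [0,T]`: `‖u(t)‖ ≤ ‖v_n(t)‖ + ‖u(t) - v_n(t)‖ ≤ ‖u₀ⁿ‖ + o(1) ≤ ‖u(0)‖ + o(1)`. No rate,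
no relation between `ν_n` and `n`, and no equation for `u` are needed. [folklore] -/
theorem lerayHopfLimit_eLpNorm_le_initial {T : ℝ} {u : ℝ → 𝕋³ → E³}
    (hu : ∀ t ∈ Icc 0 T, MemLp (u t) 2 volume) {ν : ℕ → ℝ} {u₀ : ℕ → 𝕋³ → E³}
    {v : ℕ → ℝ → 𝕋³ → E³} (hν : ∀ n, 0 ≤ ν n) (hu₀ : ∀ n, MemLp (u₀ n) 2 volume)
    (hv : ∀ n, Torus.IsLerayHopfOn T (ν n) 0 (u₀ n) (v n))
    (hdata : Tendsto (fun n => eLpNorm (u₀ n - u 0) 2 volume) atTop (𝓝 0))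
    (hconv : Tendsto (fun n => ⨆ t ∈ Icc 0 T, eLpNorm (v n t - u t) 2 volume) atTop (𝓝 0))
    {t : ℝ} (ht : t ∈ Icc 0 T) : eLpNorm (u t) 2 volume ≤ eLpNorm (u 0) 2 volume := by
  have h0 : (0 : ℝ) ∈ Icc 0 T := ⟨le_rfl, ht.1.trans ht.2⟩
  have hchain : ∀ n, eLpNorm (u t) 2 volume ≤
      eLpNorm (u 0) 2 volume + eLpNorm (u₀ n - u 0) 2 volume + eLpNorm (v n t - u t) 2 volume := by
    intro n
    calc eLpNorm (u t) 2 volume ≤ eLpNorm (v n t) 2 volume + eLpNorm (v n t - u t) 2 volume :=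
          eLpNorm_le_add_eLpNorm_sub (hu t ht) ((hv n).memLp t ht)
      _ ≤ eLpNorm (u₀ n) 2 volume + eLpNorm (v n t - u t) 2 volume := by
          gcongr
          exact IsLerayHopfOn.eLpNorm_le_initial_of_unforced (hν n) (hv n) (hu₀ n) ht
      _ ≤ eLpNorm (u 0) 2 volume + eLpNorm (u₀ n - u 0) 2 volume + eLpNorm (v n t - u t) 2 volume := by
          gcongr
          exact eLpNorm_le_add_eLpNorm_sub' (hu₀ n) (hu 0 h0)
  have hlim : Tendsto (fun n => eLpNorm (u 0) 2 volume + eLpNorm (u₀ n - u 0) 2 volume +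
      eLpNorm (v n t - u t) 2 volume) atTop (𝓝 (eLpNorm (u 0) 2 volume)) := by
    simpa using ((tendsto_const_nhds (x := eLpNorm (u 0) 2 volume)).add hdata).add
      (tendsto_eLpNorm_slice_of_tendsto_iSup hconv ht)
  exact le_of_tendsto_of_tendsto' tendsto_const_nhds hlim hchain

/-- **Limits of unforced Leray–Hopf solutions are dissipative (a.e. form).** Under the same
hypotheses, for a.e. `s ∈ (0,T)` and every `t ∈ [s,T]`: `‖u(t)‖_{L²} ≤ ‖u(s)‖_{L²}` — the energy
inequalities from a.e. `s` of the `v_n` [cite: Leray1934, §III (5.1)] hold simultaneously for all `n`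
off one null set and pass to the limit there. [folklore] -/
theorem lerayHopfLimit_eLpNorm_le_ae {T : ℝ} {u : ℝ → 𝕋³ → E³}
    (hu : ∀ t ∈ Icc 0 T, MemLp (u t) 2 volume) {ν : ℕ → ℝ} {u₀ : ℕ → 𝕋³ → E³}
    {v : ℕ → ℝ → 𝕋³ → E³} (hν : ∀ n, 0 ≤ ν n)
    (hv : ∀ n, Torus.IsLerayHopfOn T (ν n) 0 (u₀ n) (v n))
    (hconv : Tendsto (fun n => ⨆ t ∈ Icc 0 T, eLpNorm (v n t - u t) 2 volume) atTop (𝓝 0)) :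
    ∀ᵐ s ∂(volume.restrict (Ioo 0 T)), ∀ t ∈ Icc s T,
      eLpNorm (u t) 2 volume ≤ eLpNorm (u s) 2 volume := by
  have hall : ∀ᵐ s ∂(volume.restrict (Ioo 0 T)), ∀ n, ∀ t ∈ Icc s T,
      eLpNorm (v n t) 2 volume ≤ eLpNorm (v n s) 2 volume :=
    ae_all_iff.2 fun n => IsLerayHopfOn.eLpNorm_le_ae_of_unforced (hν n) (hv n)
  filter_upwards [hall, ae_restrict_mem measurableSet_Ioo] with s hs hsmem t ht
  have hsI : s ∈ Icc 0 T := ⟨hsmem.1.le, hsmem.2.le⟩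
  have htI : t ∈ Icc 0 T := ⟨hsmem.1.le.trans ht.1, ht.2⟩
  have hchain : ∀ n, eLpNorm (u t) 2 volume ≤
      eLpNorm (u s) 2 volume + eLpNorm (v n s - u s) 2 volume + eLpNorm (v n t - u t) 2 volume := by
    intro n
    calc eLpNorm (u t) 2 volume ≤ eLpNorm (v n t) 2 volume + eLpNorm (v n t - u t) 2 volume :=
          eLpNorm_le_add_eLpNorm_sub (hu t htI) ((hv n).memLp t htI)
      _ ≤ eLpNorm (v n s) 2 volume + eLpNorm (v n t - u t) 2 volume := by
          gcongr
          exact hs n t ht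
      _ ≤ eLpNorm (u s) 2 volume + eLpNorm (v n s - u s) 2 volume + eLpNorm (v n t - u t) 2 volume := by
          gcongr
          exact eLpNorm_le_add_eLpNorm_sub' ((hv n).memLp s hsI) (hu s hsI)
  have hlim : Tendsto (fun n => eLpNorm (u s) 2 volume + eLpNorm (v n s - u s) 2 volume +
      eLpNorm (v n t - u t) 2 volume) atTop (𝓝 (eLpNorm (u s) 2 volume)) := by
    simpa using ((tendsto_const_nhds (x := eLpNorm (u s) 2 volume)).add
      (tendsto_eLpNorm_slice_of_tendsto_iSup hconv hsI)).add
      (tendsto_eLpNorm_slice_of_tendsto_iSup hconv htI)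
  exact le_of_tendsto_of_tendsto' tendsto_const_nhds hlim hchain

/-- **Limits of unforced Leray–Hopf solutions are dissipative (everywhere form).** If in addition
`t ↦ ‖u(t)‖_{L²}` is continuous on `[0,T]` (e.g. `u ∈ C⁰([0,T]; L²)`, as every Hölder flow of
[cite: BuckmasterVicol2019Annals, Thm. 1.3] is), then it is non-increasing on `[0,T]`: the
a.e. statement is upgraded through right-continuity, a null subset of `(0,T)` containing no
interval. [folklore] -/
theorem lerayHopfLimit_eLpNorm_antitoneOn {T : ℝ} {u : ℝ → 𝕋³ → E³}
    (hu : ∀ t ∈ Icc 0 T, MemLp (u t) 2 volume)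
    (hcont : ContinuousOn (fun t => eLpNorm (u t) 2 volume) (Icc 0 T)) {ν : ℕ → ℝ}
    {u₀ : ℕ → 𝕋³ → E³} {v : ℕ → ℝ → 𝕋³ → E³} (hν : ∀ n, 0 ≤ ν n)
    (hv : ∀ n, Torus.IsLerayHopfOn T (ν n) 0 (u₀ n) (v n))
    (hconv : Tendsto (fun n => ⨆ t ∈ Icc 0 T, eLpNorm (v n t - u t) 2 volume) atTop (𝓝 0)) :
    AntitoneOn (fun t => eLpNorm (u t) 2 volume) (Icc 0 T) := by
  set φ : ℝ → ℝ≥0∞ := fun t => eLpNorm (u t) 2 volume with hφ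
  have hae := lerayHopfLimit_eLpNorm_le_ae hu hν hv hconv
  intro s₀ hs₀ t ht hst
  rcases hst.eq_or_lt with rfl | hlt
  · exact le_rfl
  -- argue by contradiction: if `φ t > φ s₀`, right-continuity at `s₀` gives a window `(s₀, s₁)`
  -- on which `φ < φ t`, and that window must contain a good time `s`
  by_contra hcon
  have hgt : φ s₀ < φ t := lt_of_not_ge hcon
  -- right-continuity at `s₀` within `[0,T]`
  have hcs : ContinuousWithinAt φ (Icc 0 T) s₀ := hcont s₀ hs₀
  have hev : ∀ᶠ s in 𝓝[Icc 0 T] s₀, φ s < φ t := hcs (Iio_mem_nhds hgt)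
  obtain ⟨δ, hδ, hδP⟩ : ∃ δ > 0, ∀ s ∈ Icc 0 T, dist s s₀ < δ → φ s < φ t := by
    rcases (Metric.nhdsWithin_basis_ball.eventually_iff).1 hev with ⟨δ, hδ, h⟩
    exact ⟨δ, hδ, fun s hs hd => h ⟨hd, hs⟩⟩
  set s₁ : ℝ := min t (s₀ + δ / 2) with hs₁
  have hs₀₁ : s₀ < s₁ := lt_min hlt (by linarith)
  have hsub : Ioo s₀ s₁ ⊆ Ioo 0 T := fun s hs =>
    ⟨hs₀.1.trans_lt hs.1, lt_of_lt_of_le hs.2 ((min_le_left _ _).trans ht.2)⟩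
  -- the good times form a set of full measure in `(0,T)`; hence one lies in `(s₀, s₁)`
  have hgood : ∃ s ∈ Ioo s₀ s₁, ∀ t' ∈ Icc s T, φ t' ≤ φ s := by
    by_contra hnone
    push Not at hnone
    have hzero : volume.restrict (Ioo 0 T) (Ioo s₀ s₁) = 0 := by
      refine measure_eq_zero_iff_ae_notMem.2 ?_
      filter_upwards [hae] with s hs hmem
      obtain ⟨t', ht', hlt'⟩ := hnone s hmem
      exact absurd (hs t' ht') (not_le.2 hlt')
    rw [Measure.restrict_apply measurableSet_Ioo, inter_eq_left.2 hsub, Real.volume_Ioo] at hzero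
    have : (0 : ℝ) < s₁ - s₀ := by linarith
    exact absurd hzero (by positivity)
  obtain ⟨s, hs, hsP⟩ := hgood
  have hsT : s ∈ Icc 0 T := ⟨(hsub hs).1.le, (hsub hs).2.le⟩
  have hdist : dist s s₀ < δ := by
    rw [Real.dist_eq, abs_of_pos (by linarith [hs.1])]
    have : s < s₀ + δ / 2 := lt_of_lt_of_le hs.2 (min_le_right _ _)
    linarith
  have h1 : φ s < φ t := hδP s hsT hdist
  have h2 : φ t ≤ φ s := hsP t ⟨(lt_of_lt_of_le hs.2 (min_le_left _ _)).le, ht.2⟩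
  exact absurd h1 (not_lt.2 h2)

/-- The same ceiling for the kinetic energy `E(u(t)) = ½∫|u(t)|²` (`Torus.kineticEnergy (u t)`,
definitionally the `energyProfile u t` of `Literature.Analysis.FluidPDE.onsager_flexibility`):
`E(u(t)) ≤ E(u(0))` on `[0,T]`. [folklore] -/
theorem lerayHopfLimit_kineticEnergy_le_initial {T : ℝ} {u : ℝ → 𝕋³ → E³}
    (hu : ∀ t ∈ Icc 0 T, MemLp (u t) 2 volume) {ν : ℕ → ℝ} {u₀ : ℕ → 𝕋³ → E³}
    {v : ℕ → ℝ → 𝕋³ → E³} (hν : ∀ n, 0 ≤ ν n) (hu₀ : ∀ n, MemLp (u₀ n) 2 volume)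
    (hv : ∀ n, Torus.IsLerayHopfOn T (ν n) 0 (u₀ n) (v n))
    (hdata : Tendsto (fun n => eLpNorm (u₀ n - u 0) 2 volume) atTop (𝓝 0))
    (hconv : Tendsto (fun n => ⨆ t ∈ Icc 0 T, eLpNorm (v n t - u t) 2 volume) atTop (𝓝 0))
    {t : ℝ} (ht : t ∈ Icc 0 T) : Torus.kineticEnergy (u t) ≤ Torus.kineticEnergy (u 0) := by
  have h0 : (0 : ℝ) ∈ Icc 0 T := ⟨le_rfl, ht.1.trans ht.2⟩
  have h := lerayHopfLimit_eLpNorm_le_initial hu hν hu₀ hv hdata hconv ht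
  have h' : (eLpNorm (u t) 2 volume).toReal ≤ (eLpNorm (u 0) 2 volume).toReal :=
    (ENNReal.toReal_le_toReal (hu t ht).eLpNorm_ne_top (hu 0 h0).eLpNorm_ne_top).2 h
  rw [kineticEnergy_eq_half_toReal_sq (hu t ht), kineticEnergy_eq_half_toReal_sq (hu 0 h0)]
  have ha : 0 ≤ (eLpNorm (u t) 2 volume).toReal := ENNReal.toReal_nonneg
  nlinarith

/-! ## The narrowed barrier statement -/

/-- **Narrowed barrier: only dissipative flows are `C⁰_t L²` vanishing-viscosity limits of
unforced Leray–Hopf solutions** (narrowing the clause "no printed theorem excludes a Leray–Hopf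
(or classical) vanishing-viscosity realisation of a convex-integration solution" in the block of
`BuckmasterVicol2019_thm13`). For every `T`, every field `u : ℝ → T³ → ℝ³` with slices in `L²`
on `[0,T]` and `t ↦ ‖u(t)‖_{L²}` continuous on `[0,T]` (e.g. any `u ∈ C⁰([0,T]; L²)`, in
particular every Hölder flow), and every sequence of unforced Leray–Hopf solutions `v_n` on
`T³ × [0,T)` (accepted `Torus.IsLerayHopfOn T ν_n 0 u₀ⁿ v_n`; any viscosities `ν_n ≥ 0`, any data)
with `sup_{t ∈ [0,T]} ‖v_n(t) - u(t)‖_{L²} → 0` — the convergence of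
[cite: BuckmasterVicol2019Annals, Thm. 1.3] — the map `t ↦ ‖u(t)‖_{L²}` is non-increasing on
`[0,T]`.

BARRIER (D-0021):
- technique_class: convex-integration onsager-flexibility prescribed-energy-profile compact-time-support vanishing-viscosity-limit unforced-leray-hopf energy-inequality
- blocks: realisation, in the `C⁰_t L²_x` mode of [cite: BuckmasterVicol2019Annals, Thm. 1.3] (or any stronger one), of a NON-DISSIPATIVE weak Euler flow on `T³` — `‖u(s)‖_{L²} < ‖u(t)‖_{L²}` for some `0 ≤ s < t ≤ T` — as a limit of unforced Leray–Hopf solutions, whatever the viscosities and the data (`not_lerayHopfLimit_of_eLpNorm_lt_of_le`): every witness of `Literature.Analysis.FluidPDE.onsager_flexibility` for a prescribed profile `e` that is not non-increasing [cite: BDLSV2019, Thm. 1.1], every non-trivial flow at rest at `t = 0` such as the compactly time-supported ones of [cite: Isett2018, Thm. 1] (`not_lerayHopfLimit_of_rest`), the time reversals `-u(-t,·)` of strictly dissipative flows, and the weak Euler flows with any non-monotone energy; for all of these the realisability by weak (Oseen) Navier–Stokes solutions of Thm. 1.3 is the whole printed reach.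
- because: the energy inequalities of an unforced Leray–Hopf solution — from `0` [cite: Leray1934, §III (5.2)] and from a.e. `s ∈ (0,T)` [cite: Leray1934, §III (5.1)] — have zero work term and nonnegative dissipation, so `‖v_n(t)‖_{L²} ≤ ‖v_n(s)‖_{L²}` for a.e. `s` and all `t ≥ s` (`IsLerayHopfOn.eLpNorm_le_ae_of_unforced`), simultaneously for all `n` off one null set; both sides pass to the limit under uniform-in-time `L²` convergence (`lerayHopfLimit_eLpNorm_le_ae`, no rate and no coupling `ν_n ↔ n` needed), and right-continuity of `t ↦ ‖u(t)‖_{L²}` removes the null set, which contains no interval (`lerayHopfLimit_eLpNorm_antitoneOn`) [folklore].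
- evasions_known: none for the flows in `blocks:` (a theorem); the statement is void exactly for dissipative flows (`t ↦ ‖u(t)‖_{L²}` non-increasing), which is where the parent's documented gap lives [cite: BuckmasterVicol2019Annals, §1.2] [cite: BrueDeLellis2023, §2]; for suitable (or Leray's) approximants converging strongly in `L³_{t,x}` the limit must moreover satisfy the LOCAL energy inequality `D(u) ≥ 0` [cite: DuchonRobert2000, Prop. 4] [cite: GiriKwonNovack2026, p. 3], so the live target class for a Leray–Hopf or classical realisation is the globally dissipative one, populated by convex integration in `C^{1/15-}` [cite: Isett2022, Thm. 1], `C^{1/7-}` [cite: DelellisKwon2022, Thm. 1.1] and `C⁰_t(B^{β}_{3,∞} ∩ L^{1/(1-3β)})`, `β < 1/3` [cite: GiriKwonNovack2026, Thm. 1.1]; forced realisations with a steady force `f` (the summit's setting) obey instead the forced inequalities `E(t) ≤ E(s) + ∫ₛᵗ(f,u)`, which constrain but do not exclude periodic flows with positive input.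
- scope_caveats: unforced Navier–Stokes only (zero work term); solutions convergent in `C⁰([0,T]; L²)` as in Thm. 1.3 (for mere `L²_{t,x}` convergence only the a.e. form survives along a subsequence, not proved here); continuity of `t ↦ ‖u(t)‖_{L²}` is used for the everywhere form (without it: `lerayHopfLimit_eLpNorm_le_ae`, and the ceiling from `t = 0` under `L²`-convergent data, `lerayHopfLimit_eLpNorm_le_initial`); nothing is said about dissipative flows, about weak (Oseen) approximants (Thm. 1.3 realises every Hölder flow by those), about `ν`-dependent or steady forces, or about the local energy inequality (not formalised here).
- status: established (theorem `ConvexIntegrationNonLerayEnergyCeilingNarrow_holds` below) [folklore] -/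
def ConvexIntegrationNonLerayEnergyCeilingNarrow : Prop :=
  ∀ (T : ℝ) (u : ℝ → 𝕋³ → E³), (∀ t ∈ Icc 0 T, MemLp (u t) 2 volume) →
    ContinuousOn (fun t => eLpNorm (u t) 2 volume) (Icc 0 T) →
  ∀ (ν : ℕ → ℝ) (u₀ : ℕ → 𝕋³ → E³) (v : ℕ → ℝ → 𝕋³ → E³), (∀ n, 0 ≤ ν n) →
    (∀ n, Torus.IsLerayHopfOn T (ν n) 0 (u₀ n) (v n)) →
    Tendsto (fun n => ⨆ t ∈ Icc 0 T, eLpNorm (v n t - u t) 2 volume) atTop (𝓝 0) →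
    AntitoneOn (fun t => eLpNorm (u t) 2 volume) (Icc 0 T)

/-- The narrowed barrier holds (it is `lerayHopfLimit_eLpNorm_antitoneOn`). [folklore] -/
theorem ConvexIntegrationNonLerayEnergyCeilingNarrow_holds :
    ConvexIntegrationNonLerayEnergyCeilingNarrow :=
  fun _T _u hu hcont _ν _u₀ _v hν hv hconv => lerayHopfLimit_eLpNorm_antitoneOn hu hcont hν hv hconv

/-! ## The exclusions -/

/-- **Energy gain between two times excludes Leray–Hopf realisation.** If `t ↦ ‖u(t)‖_{L²}` is
continuous on `[0,T]` and `‖u(s)‖_{L²} < ‖u(t)‖_{L²}` for some `0 ≤ s ≤ t ≤ T`, then there are NO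
viscosities `ν_n ≥ 0`, data `u₀ⁿ` and unforced Leray–Hopf solutions `v_n` with
`sup_{[0,T]} ‖v_n - u‖_{L²} → 0`. Applies to every Onsager-flexibility flow whose prescribed energy
profile is not non-increasing [cite: BDLSV2019, Thm. 1.1], each of which is nevertheless a
`C⁰_t L²` limit of weak Navier–Stokes solutions [cite: BuckmasterVicol2019Annals, Thm. 1.3]. [folklore] -/
theorem not_lerayHopfLimit_of_eLpNorm_lt_of_le {T : ℝ} {u : ℝ → 𝕋³ → E³}
    (hu : ∀ t ∈ Icc 0 T, MemLp (u t) 2 volume)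
    (hcont : ContinuousOn (fun t => eLpNorm (u t) 2 volume) (Icc 0 T)) {s t : ℝ}
    (hs : s ∈ Icc 0 T) (ht : t ∈ Icc 0 T) (hst : s ≤ t)
    (hgain : eLpNorm (u s) 2 volume < eLpNorm (u t) 2 volume) :
    ¬ ∃ (ν : ℕ → ℝ) (u₀ : ℕ → 𝕋³ → E³) (v : ℕ → ℝ → 𝕋³ → E³), (∀ n, 0 ≤ ν n) ∧
        (∀ n, Torus.IsLerayHopfOn T (ν n) 0 (u₀ n) (v n)) ∧
        Tendsto (fun n => ⨆ r ∈ Icc 0 T, eLpNorm (v n r - u r) 2 volume) atTop (𝓝 0) := by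
  rintro ⟨ν, u₀, v, hν, hv, hconv⟩
  exact absurd hgain (not_lt.2 (lerayHopfLimit_eLpNorm_antitoneOn hu hcont hν hv hconv hs ht hst))

/-- **Energy above the initial energy excludes Leray–Hopf realisation from convergent data** (no
continuity needed): if `‖u(0)‖_{L²} < ‖u(t)‖_{L²}` for some `t ∈ [0,T]` (slices in `L²`), there are
no `ν_n ≥ 0`, data `u₀ⁿ → u(0)` in `L²` and unforced Leray–Hopf solutions `v_n` with
`sup_{[0,T]} ‖v_n - u‖_{L²} → 0`. [folklore] -/
theorem not_lerayHopfLimit_of_eLpNorm_lt {T : ℝ} {u : ℝ → 𝕋³ → E³}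
    (hu : ∀ t ∈ Icc 0 T, MemLp (u t) 2 volume) {t : ℝ} (ht : t ∈ Icc 0 T)
    (hgain : eLpNorm (u 0) 2 volume < eLpNorm (u t) 2 volume) :
    ¬ ∃ (ν : ℕ → ℝ) (u₀ : ℕ → 𝕋³ → E³) (v : ℕ → ℝ → 𝕋³ → E³),
        (∀ n, 0 ≤ ν n) ∧ (∀ n, MemLp (u₀ n) 2 volume) ∧
        (∀ n, Torus.IsLerayHopfOn T (ν n) 0 (u₀ n) (v n)) ∧
        Tendsto (fun n => eLpNorm (u₀ n - u 0) 2 volume) atTop (𝓝 0) ∧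
        Tendsto (fun n => ⨆ s ∈ Icc 0 T, eLpNorm (v n s - u s) 2 volume) atTop (𝓝 0) := by
  rintro ⟨ν, u₀, v, hν, hu₀, hv, hdata, hconv⟩
  exact absurd hgain (not_lt.2 (lerayHopfLimit_eLpNorm_le_initial hu hν hu₀ hv hdata hconv ht))

/-- **Rest at `t = 0` excludes Leray–Hopf realisation of anything non-trivial**: if `u(0) = 0`
and `‖u(t)‖_{L²} ≠ 0` for some `t ∈ [0,T]` (slices in `L²`), then `u` is not a `C⁰_t L²` limit
of unforced Leray–Hopf solutions with data `u₀ⁿ → 0` in `L²` — the case of the compactly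
time-supported wild solutions [cite: Isett2018, Thm. 1] after a time shift. [folklore] -/
theorem not_lerayHopfLimit_of_rest {T : ℝ} {u : ℝ → 𝕋³ → E³}
    (hu : ∀ t ∈ Icc 0 T, MemLp (u t) 2 volume) (hrest : u 0 = 0) {t : ℝ} (ht : t ∈ Icc 0 T)
    (hne : eLpNorm (u t) 2 volume ≠ 0) :
    ¬ ∃ (ν : ℕ → ℝ) (u₀ : ℕ → 𝕋³ → E³) (v : ℕ → ℝ → 𝕋³ → E³),
        (∀ n, 0 ≤ ν n) ∧ (∀ n, MemLp (u₀ n) 2 volume) ∧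
        (∀ n, Torus.IsLerayHopfOn T (ν n) 0 (u₀ n) (v n)) ∧
        Tendsto (fun n => eLpNorm (u₀ n - u 0) 2 volume) atTop (𝓝 0) ∧
        Tendsto (fun n => ⨆ s ∈ Icc 0 T, eLpNorm (v n s - u s) 2 volume) atTop (𝓝 0) := by
  refine not_lerayHopfLimit_of_eLpNorm_lt hu ht ?_
  rw [hrest]
  simpa using pos_iff_ne_zero.2 hne

end Literature.Barriers.AnomalousDissipation

end
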